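import Summits.QuantumFields.BalabanUV.T4Continuum.Support.TorusLineHolonomy

/-!
# TorusHolonomySpreading — BRICK B3b of the requested lattice lemma `torusSmallFieldGlobalGauge` (INTERFACE REQUEST NE7, route #1 of
# the NE7 crux, stub S7 NODE O): ONE-DIRECTION HOLONOMY SPREADING on the discrete 4-torus — the gauge `g(x) = A_r(W(b))·V(b → x)` built
# from an ABSTRACT path family `A_t` (`A_0 = 1`, `A_M(W) = W⁻¹`, unitary, steps `≤ σ∕M`, `Λ`-Lipschitz, conjugation-equivariant on a
# conjugation-invariant set `G` containing all Polyakov holonomies): it is unitary and `M`-periodic, every `μ`-bond of `V^g` is within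
# `σ∕M` of `1`, and every transverse bond within `3‖V(b, κ) − 1‖ + (1 + Λ)·M·η` of `1`; plus the PERIODIC REDUCTION helpers and the
# MARGIN WALK across the torus (an abstract `Good s` family degrading by `M·η` per lattice step)

Cell `pub-balaban`, rung (B)+1 sub-cell t4, lineage `b2b-balaban-t4-ne7-p1`, generation 26 (CRUX PROVER NE7 #1, ruling e34b3e0c); crux
skeleton `t4/skeletons/NE7-CRUX-R1.md` v1.7.6 §4 «INTERFACE REQUEST NE7» (HOME/INBOX.md ll.6031–6037); bricks B1 = `TorusGaugeComb` (p259900),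
B2a = `UnitaryCayley` (p260933), B3a = `TorusLineHolonomy` (line geometry, holonomies, periodic reduction).  HONEST FRAMING (page 1): FIXED FINITE T⁴, rung (B)+1; NE7, NE3 NOT PRINTED in [Balaban1984PropagatorsI]–
[Balaban1989LargeFieldII] and NOT PROVED here; continuum YM on T⁴ ⇐ BetaPertH ∧ nine spine estimates (0/9 proved); BetaPertH ⇐ (D1) ∧ (D4) ∧
CAP+tail; G-an2-4 gates asym, D1 and NE2/3/4; NOT infinite volume, NOT mass gap, NOT Clay.

THE STEP ([folklore] lattice gauge theory — «spreading the Polyakov loop uniformly along its line», here with explicit constants and the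
transverse bookkeeping).  Fix a direction `μ`, a period `M ≥ 1` and a unitary `M`-periodic `V` with `SmallField V η`.  For a site `x` let
`r = x_μ mod M ∈ [0, M)`, `b = x − r·e_μ` (the BASE), `P_r(b) = V(b → x)` the straight transporter and `W(b) = V(b → b + M e_μ)` the holonomy
(`TorusLineHolonomy.lineRes`∕`lineBase`∕`lineT`∕`holo`).  Given `A : ℕ → U(n) → U(n)` as above (`PathFamily`), the gauge `g(x) := A_r(W(b))·P_r(b)` (`spread`)
satisfies (`B7Prop1Explicit.gaugeAct`: `V^g(x, κ) = g(x)V(x, κ)g(x + e_κ)⁻¹`):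
 * `V^g(x, μ) = A_r(W)·A_{r+1}(W)⁻¹` (interior AND wrap bonds — the wrap bond is where `A_M(W) = W⁻¹` and periodicity enter), so
   `‖V^g(x, μ) − 1‖ ≤ σ∕M` (**`spread_bond_dir`**);
 * for `κ ≠ μ`: `V^g(x, κ) = A_r(W(b))·Q_r·V(b, κ)·A_r(W(b + e_κ))⁻¹` with the LADDER holonomy `Q_r` (`B7Prop1Explicit.hol_ladder`,
   `ladder_bound`: `‖Q_r − 1‖ ≤ r·η`) and `W(b + e_κ) = V(b,κ)⁻¹·Q_M⁻¹·W(b)·V(b,κ)` (`holo_transverse`), whence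
   `‖V^g(x, κ) − 1‖ ≤ 3‖V(b, κ) − 1‖ + (1 + Λ)·M·η` (**`transverse_core`** at group level, **`spread_bond_transverse`**);
 * `g` is unitary and `M`-periodic (**`spread_unitary`**, **`spread_periodic`**).
 * MARGIN WALK (**`holo_good_all`**): if `Good : ℝ → Set` is monotone in the level, conjugation-invariant and degrades by at most `ε` under
   an `ε`-perturbation, then `W(0) ∈ Good s₀ ⟹ W(b) ∈ Good (s₀ − 4M·(M·η))` for EVERY base point (walk along the comb, `M·η` per step,
   then periodic reduction `TorusLineHolonomy.periodic_reduce`).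
HONEST: elementary lattice bookkeeping with explicit constants; the path family is ABSTRACT here (instantiated by the Cayley path in brick
B2b∕B4); nothing of Bałaban asserted; nothing of NE3∕NE7 discharged; 0 sorry.
-/

set_option autoImplicit false

open scoped BigOperators Matrix Matrix.Norms.L2Operator
open Finset NormedSpace

namespace Summit.QuantumFields.BalabanUV.T4Continuum.TorusHolonomySpreading

open Literature.MathematicalPhysics.QuantumFieldTheory.Balaban1983to89
open B7Prop1Explicit B7Prop2Explicit
open T4AveragingDeficitWall hiding Site Plane Plaq Bond
open T4AveragingDeficitWallBoundary (IsPeriodicCfg)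
open NE3EnergyShapes (IsUnitarySite IsPeriodicSite)
open AveragingDeficitTransport (mem_U1_of_unitary)
open BlockAverageCurrent (smallField_gaugeAct)
open AveragingDeficitKDatum (isUnitaryCfg_gaugeAct)
open TorusGaugeComb (natSite wrapSite)
open SmoothRefineAbelianFlux (hol_add_period)
open TorusLineHolonomy

noncomputable section

/-! ## §3 The abstract path family and the spreading gauge -/

section Spread

variable {n : Type*} [Fintype n] [DecidableEq n] [Nonempty n]

/-- **AN ABSTRACT SPREADING PATH FAMILY** `A : ℕ → U(n) → U(n)` for period `M` on a set `G` of holonomies: `A_0 = 1`, `A_M(W) = W⁻¹`,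
unitary values, steps `‖A_{t+1}(W) − A_t(W)‖ ≤ σ∕M`, `Λ`-Lipschitz in `W` on `G` for `t ≤ M`, conjugation-equivariant, `G` conjugation-invariant
(instantiated by the Cayley path of brick B2b). [folklore] -/
structure PathFamily (M : ℕ) (G : Set (Matrix n n ℂ)ˣ) (A : ℕ → (Matrix n n ℂ)ˣ → (Matrix n n ℂ)ˣ) (σ Λ : ℝ) : Prop where
  zero : ∀ W, A 0 W = 1
  top : ∀ W ∈ G, A M W = W⁻¹
  unitary : ∀ W ∈ G, ∀ t, A t W ∈ unitaryUnits (Matrix n n ℂ)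
  speed : ∀ W ∈ G, ∀ t, t < M → ‖((A (t + 1) W : (Matrix n n ℂ)ˣ) : Matrix n n ℂ) - A t W‖ ≤ σ / M
  lip : ∀ W ∈ G, ∀ W' ∈ G, ∀ t, t ≤ M →
    ‖((A t W : (Matrix n n ℂ)ˣ) : Matrix n n ℂ) - A t W'‖ ≤ Λ * ‖((W : (Matrix n n ℂ)ˣ) : Matrix n n ℂ) - W'‖
  equiv : ∀ W ∈ G, ∀ B ∈ unitaryUnits (Matrix n n ℂ), ∀ t, A t (B * W * B⁻¹) = B * A t W * B⁻¹
  conj_mem : ∀ W ∈ G, ∀ B ∈ unitaryUnits (Matrix n n ℂ), B * W * B⁻¹ ∈ G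

variable (M : ℕ) (μ : Fin 4)

/-- **THE SPREADING GAUGE** `g(x) = A_r(W(b))·P_r(b)`. [folklore] -/
def spread (A : ℕ → (Matrix n n ℂ)ˣ → (Matrix n n ℂ)ˣ) (V : Site 4 → Fin 4 → (Matrix n n ℂ)ˣ) (x : Site 4) : (Matrix n n ℂ)ˣ :=
  A (lineRes M μ x).toNat (holo M μ V x) * lineT M μ V x

variable {M μ} {G : Set (Matrix n n ℂ)ˣ} {A : ℕ → (Matrix n n ℂ)ˣ → (Matrix n n ℂ)ˣ} {σ Λ : ℝ}
  {V : Site 4 → Fin 4 → (Matrix n n ℂ)ˣ} {η : ℝ}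

omit [Nonempty n] in
/-- The spreading gauge is `M`-periodic. [folklore] -/
theorem spread_periodic (hP : IsPeriodicCfg V (M : ℤ)) : IsPeriodicSite (spread M μ A V) (M : ℤ) := by
  intro x i
  simp only [spread, lineT, (lineRes_add_period x i).1, (lineRes_add_period x i).2, holo_add_period hP, hol_add_period V hP]

omit [Nonempty n] in
/-- The spreading gauge is unitary (holonomies in `G`). [folklore] -/
theorem spread_unitary (hA : PathFamily M G A σ Λ) (hU : IsUnitaryCfg V) (hG : ∀ x, holo M μ V x ∈ G) :
    IsUnitarySite (spread M μ A V) :=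
  fun x => (unitaryUnits (Matrix n n ℂ)).mul_mem (hA.unitary _ (hG x) _) (hol_mem_of hU _ _)

omit [Nonempty n] in
/-- `(r.toNat : ℤ) = r` and `r.toNat < M` for the residue. [folklore] -/
theorem toNat_lineRes (hM : 1 ≤ M) (x : Site 4) : ((lineRes M μ x).toNat : ℤ) = lineRes M μ x ∧ (lineRes M μ x).toNat < M := by
  have h := lineRes_bounds (μ := μ) hM x
  refine ⟨Int.toNat_of_nonneg h.1, ?_⟩
  have : ((lineRes M μ x).toNat : ℤ) < (M : ℤ) := by rw [Int.toNat_of_nonneg h.1]; exact h.2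
  exact_mod_cast this

omit [Nonempty n] in
/-- **THE `μ`-BONDS OF `V^g`**: `V^g(x, μ) = A_r(W)·A_{r+1}(W)⁻¹` (interior and wrap bonds alike). [folklore] -/
theorem gaugeAct_spread_dir (hM : 1 ≤ M) (hA : PathFamily M G A σ Λ) (hP : IsPeriodicCfg V (M : ℤ)) (hG : ∀ x, holo M μ V x ∈ G)
    (x : Site 4) :
    gaugeAct (spread M μ A V) V x μ =
      A (lineRes M μ x).toNat (holo M μ V x) * (A ((lineRes M μ x).toNat + 1) (holo M μ V x))⁻¹ := by
  have hr := toNat_lineRes (μ := μ) hM x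
  -- `P_{r+1} = P_r · V(x, μ)`
  have hstep : hol V (lineBase M μ x) (seg μ (lineRes M μ x + 1)) = hol V (lineBase M μ x) (seg μ (lineRes M μ x)) * V x μ := by
    rw [hol_seg_succ, lineBase_add]
  rcases lt_or_eq_of_le (show lineRes M μ x + 1 ≤ (M : ℤ) by have := (lineRes_bounds (μ := μ) hM x).2; omega) with h | h
  · -- interior bond
    have hgeo := lineRes_add_dir_interior hM x h
    have hW : holo M μ V (x + e μ) = holo M μ V x := holo_add_dir hM hP x
    have hto : (lineRes M μ x + 1).toNat = (lineRes M μ x).toNat + 1 := by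
      have : ((lineRes M μ (x + e μ)).toNat : ℤ) = ((lineRes M μ x).toNat : ℤ) + 1 := by
        rw [(toNat_lineRes (μ := μ) hM (x + e μ)).1, hr.1, hgeo.1]
      rw [hgeo.1] at this
      exact_mod_cast this
    simp only [gaugeAct, spread, lineT, hW, hgeo.2, hgeo.1, hto, hstep]
    group
  · -- wrap bond: `g(x + e_μ) = A_0(·)·1 = 1`, `P_{M-1}·V(x,μ) = W`, `A_M(W) = W⁻¹`
    have hgeo := lineRes_add_dir_wrap x h
    have hto0 : (lineRes M μ (x + e μ)).toNat = 0 := by rw [hgeo.1]; rfl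
    have htoM : (lineRes M μ x).toNat + 1 = M := by
      have : ((lineRes M μ x).toNat : ℤ) + 1 = (M : ℤ) := by rw [hr.1]; exact h
      exact_mod_cast this
    have hPW : hol V (lineBase M μ x) (seg μ (lineRes M μ x)) * V x μ = holo M μ V x := by
      rw [← hstep, h]; rfl
    rw [htoM, hA.top _ (hG x), inv_inv]
    simp only [gaugeAct, spread, lineT, hgeo.1, Int.toNat_zero, hA.zero, seg_zero, hol_nil, mul_one, inv_one]
    rw [mul_assoc, hPW]

/-- **THE `μ`-BOND BOUND**: `‖V^g(x, μ) − 1‖ ≤ σ∕M`. [folklore] -/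
theorem spread_bond_dir (hM : 1 ≤ M) (hA : PathFamily M G A σ Λ) (hP : IsPeriodicCfg V (M : ℤ)) (hG : ∀ x, holo M μ V x ∈ G)
    (x : Site 4) : ‖((gaugeAct (spread M μ A V) V x μ : (Matrix n n ℂ)ˣ) : Matrix n n ℂ) - 1‖ ≤ σ / M := by
  have hr := toNat_lineRes (μ := μ) hM x
  rw [gaugeAct_spread_dir hM hA hP hG x]
  set W := holo M μ V x
  set r := (lineRes M μ x).toNat
  have hu1 : A (r + 1) W ∈ unitaryUnits (Matrix n n ℂ) := hA.unitary _ (hG x) _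
  -- `A_r A_{r+1}⁻¹ − 1 = (A_r − A_{r+1}) A_{r+1}⁻¹`
  have e1 : ((A r W * (A (r + 1) W)⁻¹ : (Matrix n n ℂ)ˣ) : Matrix n n ℂ) - 1
      = (((A r W : (Matrix n n ℂ)ˣ) : Matrix n n ℂ) - A (r + 1) W) * (((A (r + 1) W)⁻¹ : (Matrix n n ℂ)ˣ) : Matrix n n ℂ) := by
    rw [sub_mul, Units.val_mul, Units.mul_inv]
  rw [e1]
  calc _ ≤ ‖((A r W : (Matrix n n ℂ)ˣ) : Matrix n n ℂ) - A (r + 1) W‖ * ‖(((A (r + 1) W)⁻¹ : (Matrix n n ℂ)ˣ) : Matrix n n ℂ)‖ :=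
        norm_mul_le _ _
    _ ≤ ‖((A r W : (Matrix n n ℂ)ˣ) : Matrix n n ℂ) - A (r + 1) W‖ * 1 :=
        mul_le_mul_of_nonneg_left (mem_U1_of_unitary hu1).2 (norm_nonneg _)
    _ ≤ σ / M := by rw [mul_one, norm_sub_rev]; exact hA.speed _ (hG x) _ hr.2

omit [Nonempty n] in
/-- **THE TRANSVERSE BONDS OF `V^g`** (`κ ≠ μ`): `V^g(x, κ) = A_r(W(b))·(Q_r·V(b, κ))·A_r(W(b + e_κ))⁻¹` with the ladder holonomy
`Q_r = V(ladder_r)` based at `b`. [folklore] -/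
theorem gaugeAct_spread_transverse {κ : Fin 4} (hκ : κ ≠ μ) (x : Site 4) :
    gaugeAct (spread M μ A V) V x κ =
      A (lineRes M μ x).toNat (holo M μ V x) *
        (hol V (lineBase M μ x) (ladder (seg μ (lineRes M μ x)) κ) * V (lineBase M μ x) κ) *
          (A (lineRes M μ x).toNat (holo M μ V (x + e κ)))⁻¹ := by
  have hgeo := lineRes_add_transverse (M := M) hκ x
  simp only [gaugeAct, spread, lineT, hgeo.1, hgeo.2, hol_ladder, disp_seg, lineBase_add]
  group

/-- `‖XY − 1‖ ≤ ‖X − 1‖ + ‖Y − 1‖` for unitary `X` (as `B8Ineq170.norm_mul_sub_one_le_of_norm_le_one`, restated on `M_n(ℂ)ˣ` to keep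
unification cheap). [folklore] -/
theorem norm_mul_sub_one_le {X Y : (Matrix n n ℂ)ˣ} (hX : X ∈ unitaryUnits (Matrix n n ℂ)) :
    ‖((X * Y : (Matrix n n ℂ)ˣ) : Matrix n n ℂ) - 1‖ ≤ ‖(X : Matrix n n ℂ) - 1‖ + ‖(Y : Matrix n n ℂ) - 1‖ := by
  have e1 : ((X * Y : (Matrix n n ℂ)ˣ) : Matrix n n ℂ) - 1 = (X : Matrix n n ℂ) * ((Y : Matrix n n ℂ) - 1) + ((X : Matrix n n ℂ) - 1) := by
    rw [Units.val_mul]; noncomm_ring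
  rw [e1]
  calc _ ≤ ‖(X : Matrix n n ℂ) * ((Y : Matrix n n ℂ) - 1)‖ + ‖(X : Matrix n n ℂ) - 1‖ := norm_add_le _ _
    _ ≤ ‖(X : Matrix n n ℂ)‖ * ‖(Y : Matrix n n ℂ) - 1‖ + ‖(X : Matrix n n ℂ) - 1‖ := by gcongr; exact norm_mul_le _ _
    _ ≤ 1 * ‖(Y : Matrix n n ℂ) - 1‖ + ‖(X : Matrix n n ℂ) - 1‖ := by gcongr; exact (mem_U1_of_unitary hX).1
    _ = _ := by ring

/-- `‖X − B⁻¹ X B‖ ≤ 2‖B − 1‖` for unitary `X`, `B`. [folklore] -/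
theorem norm_sub_conj_le {X B : (Matrix n n ℂ)ˣ} (hX : X ∈ unitaryUnits (Matrix n n ℂ)) (hB : B ∈ unitaryUnits (Matrix n n ℂ)) :
    ‖(X : Matrix n n ℂ) - ((B⁻¹ * X * B : (Matrix n n ℂ)ˣ) : Matrix n n ℂ)‖ ≤ 2 * ‖(B : Matrix n n ℂ) - 1‖ := by
  have hX1 : ‖(X : Matrix n n ℂ)‖ ≤ 1 := (mem_U1_of_unitary hX).1
  have hB1 : ‖((B⁻¹ : (Matrix n n ℂ)ˣ) : Matrix n n ℂ)‖ ≤ 1 := (mem_U1_of_unitary hB).2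
  have hBi : ‖((B⁻¹ : (Matrix n n ℂ)ˣ) : Matrix n n ℂ) - 1‖ ≤ ‖(B : Matrix n n ℂ) - 1‖ := norm_inv_sub_one_le (mem_U1_of_unitary hB)
  have e1 : (X : Matrix n n ℂ) - ((B⁻¹ * X * B : (Matrix n n ℂ)ˣ) : Matrix n n ℂ)
      = (1 - ((B⁻¹ : (Matrix n n ℂ)ˣ) : Matrix n n ℂ)) * (X : Matrix n n ℂ)
        + ((B⁻¹ : (Matrix n n ℂ)ˣ) : Matrix n n ℂ) * (X : Matrix n n ℂ) * (1 - (B : Matrix n n ℂ)) := by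
    simp only [Units.val_mul]
    noncomm_ring
  rw [e1]
  calc _ ≤ ‖(1 - ((B⁻¹ : (Matrix n n ℂ)ˣ) : Matrix n n ℂ)) * (X : Matrix n n ℂ)‖
          + ‖((B⁻¹ : (Matrix n n ℂ)ˣ) : Matrix n n ℂ) * (X : Matrix n n ℂ) * (1 - (B : Matrix n n ℂ))‖ := norm_add_le _ _
    _ ≤ ‖1 - ((B⁻¹ : (Matrix n n ℂ)ˣ) : Matrix n n ℂ)‖ * ‖(X : Matrix n n ℂ)‖
          + ‖((B⁻¹ : (Matrix n n ℂ)ˣ) : Matrix n n ℂ)‖ * ‖(X : Matrix n n ℂ)‖ * ‖1 - (B : Matrix n n ℂ)‖ := by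
        gcongr
        · exact norm_mul_le _ _
        · exact (norm_mul_le _ _).trans (mul_le_mul_of_nonneg_right (norm_mul_le _ _) (norm_nonneg _))
    _ ≤ ‖1 - ((B⁻¹ : (Matrix n n ℂ)ˣ) : Matrix n n ℂ)‖ * 1 + 1 * 1 * ‖1 - (B : Matrix n n ℂ)‖ := by gcongr
    _ ≤ 2 * ‖(B : Matrix n n ℂ) - 1‖ := by rw [norm_sub_rev, norm_sub_rev (1 : Matrix n n ℂ)]; linarith

/-- `‖A X A'⁻¹ − 1‖ ≤ ‖X − 1‖ + ‖A − A'‖` for unitary `A`, `A'`. [folklore] -/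
theorem norm_conj2_sub_one_le {A₁ A₂ X : (Matrix n n ℂ)ˣ} (hA₁ : A₁ ∈ unitaryUnits (Matrix n n ℂ)) (hA₂ : A₂ ∈ unitaryUnits (Matrix n n ℂ)) :
    ‖((A₁ * X * A₂⁻¹ : (Matrix n n ℂ)ˣ) : Matrix n n ℂ) - 1‖
      ≤ ‖(X : Matrix n n ℂ) - 1‖ + ‖(A₁ : Matrix n n ℂ) - A₂‖ := by
  have h1 : ‖(A₁ : Matrix n n ℂ)‖ ≤ 1 := (mem_U1_of_unitary hA₁).1
  have h2 : ‖((A₂⁻¹ : (Matrix n n ℂ)ˣ) : Matrix n n ℂ)‖ ≤ 1 := (mem_U1_of_unitary hA₂).2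
  have e1 : ((A₁ * X * A₂⁻¹ : (Matrix n n ℂ)ˣ) : Matrix n n ℂ) - 1
      = (A₁ : Matrix n n ℂ) * ((X : Matrix n n ℂ) - 1) * ((A₂⁻¹ : (Matrix n n ℂ)ˣ) : Matrix n n ℂ)
        + ((A₁ : Matrix n n ℂ) - A₂) * ((A₂⁻¹ : (Matrix n n ℂ)ˣ) : Matrix n n ℂ) := by
    rw [sub_mul, Units.val_mul, Units.val_mul, Units.mul_inv]
    noncomm_ring
  rw [e1]
  calc _ ≤ ‖(A₁ : Matrix n n ℂ) * ((X : Matrix n n ℂ) - 1) * ((A₂⁻¹ : (Matrix n n ℂ)ˣ) : Matrix n n ℂ)‖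
          + ‖((A₁ : Matrix n n ℂ) - A₂) * ((A₂⁻¹ : (Matrix n n ℂ)ˣ) : Matrix n n ℂ)‖ := norm_add_le _ _
    _ ≤ ‖(A₁ : Matrix n n ℂ)‖ * ‖(X : Matrix n n ℂ) - 1‖ * ‖((A₂⁻¹ : (Matrix n n ℂ)ˣ) : Matrix n n ℂ)‖
          + ‖(A₁ : Matrix n n ℂ) - A₂‖ * ‖((A₂⁻¹ : (Matrix n n ℂ)ˣ) : Matrix n n ℂ)‖ := by
        gcongr
        · exact (norm_mul_le _ _).trans (mul_le_mul_of_nonneg_right (norm_mul_le _ _) (norm_nonneg _))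
        · exact norm_mul_le _ _
    _ ≤ 1 * ‖(X : Matrix n n ℂ) - 1‖ * 1 + ‖(A₁ : Matrix n n ℂ) - A₂‖ * 1 := by gcongr
    _ = _ := by ring

/-- The ladder holonomy over `r` steps of `e_μ` with rung `e_κ` is within `r·η` of `1` under `SmallField V η` (`B7Prop1Explicit.ladder_bound`).
[folklore] -/
theorem norm_ladder_sub_one_le (hU : IsUnitaryCfg V) (hS : SmallField V η) {κ : Fin 4} (hκ : κ ≠ μ) (b : Site 4) (r : ℕ) :
    ‖((hol V b (ladder (seg μ (r : ℤ)) κ) : (Matrix n n ℂ)ˣ) : Matrix n n ℂ) - 1‖ ≤ (r : ℝ) * η := by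
  have hV1 : ∀ x κ', V x κ' ∈ U1 (Matrix n n ℂ) := fun x κ' => mem_U1_of_unitary (hU x κ')
  have hP : ∀ (x : Site 4) (l : Letter 4), l.1 ≠ κ → ‖((hol V x (lplaqWord l κ) : (Matrix n n ℂ)ˣ) : Matrix n n ℂ) - 1‖ ≤ η :=
    fun x l hl => norm_hol_lplaqWord_sub_one_le V hV1 hS x l κ hl
  have h := ladder_bound V hV1 κ hP (seg μ (r : ℤ)) b fun l hl => by rw [mem_seg hl]; exact hκ.symm
  rw [length_seg, Int.natAbs_natCast] at h
  exact h

/-- `‖W − Q⁻¹W‖ ≤ ‖Q − 1‖` for unitary `Q`, `W`. [folklore] -/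
theorem norm_sub_inv_mul_le {Q W : (Matrix n n ℂ)ˣ} (hQ : Q ∈ unitaryUnits (Matrix n n ℂ)) (hW : W ∈ unitaryUnits (Matrix n n ℂ)) :
    ‖(W : Matrix n n ℂ) - ((Q⁻¹ * W : (Matrix n n ℂ)ˣ) : Matrix n n ℂ)‖ ≤ ‖(Q : Matrix n n ℂ) - 1‖ := by
  have e1 : (W : Matrix n n ℂ) - ((Q⁻¹ * W : (Matrix n n ℂ)ˣ) : Matrix n n ℂ) = (1 - ((Q⁻¹ : (Matrix n n ℂ)ˣ) : Matrix n n ℂ)) * (W : Matrix n n ℂ) := by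
    rw [Units.val_mul, sub_mul, one_mul]
  rw [e1]
  calc _ ≤ ‖1 - ((Q⁻¹ : (Matrix n n ℂ)ˣ) : Matrix n n ℂ)‖ * ‖(W : Matrix n n ℂ)‖ := norm_mul_le _ _
    _ ≤ ‖(Q : Matrix n n ℂ) - 1‖ * 1 := by
        gcongr
        · rw [norm_sub_rev]; exact norm_inv_sub_one_le (mem_U1_of_unitary hQ)
        · exact (mem_U1_of_unitary hW).1
    _ = _ := mul_one _

/-- **THE TRANSVERSE ESTIMATE, GROUP-LEVEL CORE**: for a path family, holonomies `W, W' ∈ G` related by `W' = B⁻¹·Q_M⁻¹·W·B` with unitary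
`B`, `Q_M`, `Q_r` and `‖Q_M − 1‖, ‖Q_r − 1‖ ≤ a`, one has `‖A_r(W)·(Q_r B)·A_r(W')⁻¹ − 1‖ ≤ 3‖B − 1‖ + (1 + Λ)·a` (`r ≤ M`). [folklore] -/
theorem transverse_core (hA : PathFamily M G A σ Λ) (hΛ : 0 ≤ Λ) {W W' B QM Qr : (Matrix n n ℂ)ˣ} {r : ℕ} (hrM : r ≤ M) {a : ℝ}
    (hWG : W ∈ G) (hW'G : W' ∈ G) (hWu : W ∈ unitaryUnits (Matrix n n ℂ)) (hBu : B ∈ unitaryUnits (Matrix n n ℂ))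
    (hQMu : QM ∈ unitaryUnits (Matrix n n ℂ)) (hQru : Qr ∈ unitaryUnits (Matrix n n ℂ)) (hrel : W' = B⁻¹ * QM⁻¹ * W * B)
    (hQM1 : ‖(QM : Matrix n n ℂ) - 1‖ ≤ a) (hQr1 : ‖(Qr : Matrix n n ℂ) - 1‖ ≤ a) :
    ‖((A r W * (Qr * B) * (A r W')⁻¹ : (Matrix n n ℂ)ˣ) : Matrix n n ℂ) - 1‖ ≤ 3 * ‖(B : Matrix n n ℂ) - 1‖ + (1 + Λ) * a := by
  -- `Y := QM⁻¹ W = B W' B⁻¹ ∈ G`, `W' = B⁻¹ Y B`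
  have hYeq : QM⁻¹ * W = B * W' * B⁻¹ := by rw [hrel]; group
  have hYG : QM⁻¹ * W ∈ G := by rw [hYeq]; exact hA.conj_mem _ hW'G _ hBu
  have hW'Y : W' = B⁻¹ * (QM⁻¹ * W) * B⁻¹⁻¹ := by rw [hYeq]; group
  have hWY : ‖(W : Matrix n n ℂ) - ((QM⁻¹ * W : (Matrix n n ℂ)ˣ) : Matrix n n ℂ)‖ ≤ a := (norm_sub_inv_mul_le hQMu hWu).trans hQM1
  have hArW : A r W ∈ unitaryUnits (Matrix n n ℂ) := hA.unitary _ hWG _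
  have hArY : A r (QM⁻¹ * W) ∈ unitaryUnits (Matrix n n ℂ) := hA.unitary _ hYG _
  have hArW' : A r W' ∈ unitaryUnits (Matrix n n ℂ) := hA.unitary _ hW'G _
  have hequiv : A r W' = B⁻¹ * A r (QM⁻¹ * W) * B⁻¹⁻¹ := by
    rw [hW'Y]; exact hA.equiv _ hYG _ ((unitaryUnits (Matrix n n ℂ)).inv_mem hBu) _
  have hAA : ‖((A r W : (Matrix n n ℂ)ˣ) : Matrix n n ℂ) - A r W'‖ ≤ Λ * a + 2 * ‖(B : Matrix n n ℂ) - 1‖ := by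
    calc _ ≤ ‖((A r W : (Matrix n n ℂ)ˣ) : Matrix n n ℂ) - A r (QM⁻¹ * W)‖
            + ‖((A r (QM⁻¹ * W) : (Matrix n n ℂ)ˣ) : Matrix n n ℂ) - A r W'‖ := norm_sub_le_norm_sub_add_norm_sub _ _ _
      _ ≤ Λ * a + 2 * ‖(B : Matrix n n ℂ) - 1‖ := by
          gcongr
          · exact (hA.lip _ hWG _ hYG _ hrM).trans (mul_le_mul_of_nonneg_left hWY hΛ)
          · rw [hequiv, inv_inv]; exact norm_sub_conj_le hArY hBu
  have hmid : ‖((Qr * B : (Matrix n n ℂ)ˣ) : Matrix n n ℂ) - 1‖ ≤ a + ‖(B : Matrix n n ℂ) - 1‖ := by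
    exact (norm_mul_sub_one_le hQru).trans (by linarith)
  calc _ ≤ ‖((Qr * B : (Matrix n n ℂ)ˣ) : Matrix n n ℂ) - 1‖ + ‖((A r W : (Matrix n n ℂ)ˣ) : Matrix n n ℂ) - A r W'‖ :=
        norm_conj2_sub_one_le hArW hArW'
    _ ≤ (a + ‖(B : Matrix n n ℂ) - 1‖) + (Λ * a + 2 * ‖(B : Matrix n n ℂ) - 1‖) := add_le_add hmid hAA
    _ = 3 * ‖(B : Matrix n n ℂ) - 1‖ + (1 + Λ) * a := by ring

/-- **THE TRANSVERSE BOND BOUND** (`κ ≠ μ`): `‖V^g(x, κ) − 1‖ ≤ 3‖V(b, κ) − 1‖ + (1 + Λ)·M·η`. [folklore] -/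
theorem spread_bond_transverse (hM : 1 ≤ M) (hA : PathFamily M G A σ Λ) (hU : IsUnitaryCfg V) (hP : IsPeriodicCfg V (M : ℤ))
    (hη : 0 ≤ η) (hS : SmallField V η) (hΛ : 0 ≤ Λ) (hG : ∀ x, holo M μ V x ∈ G) {κ : Fin 4} (hκ : κ ≠ μ) (x : Site 4) :
    ‖((gaugeAct (spread M μ A V) V x κ : (Matrix n n ℂ)ˣ) : Matrix n n ℂ) - 1‖
      ≤ 3 * ‖((V (lineBase M μ x) κ : (Matrix n n ℂ)ˣ) : Matrix n n ℂ) - 1‖ + (1 + Λ) * (M * η) := by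
  have hr := toNat_lineRes (μ := μ) hM x
  rw [gaugeAct_spread_transverse hκ x]
  have hQr1 : ‖((hol V (lineBase M μ x) (ladder (seg μ (lineRes M μ x)) κ) : (Matrix n n ℂ)ˣ) : Matrix n n ℂ) - 1‖ ≤ (M : ℝ) * η := by
    have h := norm_ladder_sub_one_le (μ := μ) hU hS hκ (lineBase M μ x) (lineRes M μ x).toNat
    rw [hr.1] at h
    exact h.trans (mul_le_mul_of_nonneg_right (by exact_mod_cast hr.2.le) hη)
  exact transverse_core hA hΛ hr.2.le (hG x) (hG (x + e κ)) (hol_mem_of hU _ _) (hU _ _) (hol_mem_of hU _ _) (hol_mem_of hU _ _)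
    (holo_transverse hκ hP x) (norm_ladder_sub_one_le (μ := μ) hU hS hκ (lineBase M μ x) M) hQr1

/-! ## §4 The margin walk: every holonomy lies in the good set -/

/-- **THE MARGIN WALK**: for a level family `Good : ℝ → Set U(n)` which is monotone in the level, conjugation-invariant and degrades by at most
`ε` under a unitary `ε`-perturbation, if the holonomy at the origin lies in `Good s₀` then EVERY holonomy lies in `Good (s₀ − 4M·(M·η))`
(one lattice step costs `M·η` by the transverse relation and the ladder bound; at most `4(M − 1)` steps inside the box; periodicity). [folklore] -/
theorem holo_good_all (hM : 1 ≤ M) (hU : IsUnitaryCfg V) (hP : IsPeriodicCfg V (M : ℤ)) (hη : 0 ≤ η) (hS : SmallField V η)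
    (Good : ℝ → Set (Matrix n n ℂ)ˣ) (hmono : ∀ s s', s' ≤ s → Good s ⊆ Good s')
    (hconj : ∀ s, ∀ W ∈ Good s, ∀ B ∈ unitaryUnits (Matrix n n ℂ), B * W * B⁻¹ ∈ Good s)
    (hpert : ∀ s ε, ∀ W ∈ Good s, ∀ W' ∈ unitaryUnits (Matrix n n ℂ),
      ‖((W' : (Matrix n n ℂ)ˣ) : Matrix n n ℂ) - W‖ ≤ ε → W' ∈ Good (s - ε))
    {s₀ : ℝ} (h0 : holo M μ V 0 ∈ Good s₀) :
    ∀ x, holo M μ V x ∈ Good (s₀ - 4 * M * (M * η)) := by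
  have hMη : 0 ≤ (M : ℝ) * η := by positivity
  -- one lattice step in any direction costs at most `M·η`
  have hstep : ∀ (s : ℝ) (x : Site 4) (i : Fin 4), holo M μ V x ∈ Good s → holo M μ V (x + e i) ∈ Good (s - M * η) := by
    intro s x i hx
    by_cases hi : i = μ
    · subst hi
      rw [holo_add_dir hM hP]
      exact hmono _ _ (by linarith) hx
    · have hQMu : hol V (lineBase M μ x) (ladder (seg μ (M : ℤ)) i) ∈ unitaryUnits (Matrix n n ℂ) := hol_mem_of hU _ _
      have hWu : holo M μ V x ∈ unitaryUnits (Matrix n n ℂ) := hol_mem_of hU _ _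
      have hY : (hol V (lineBase M μ x) (ladder (seg μ (M : ℤ)) i))⁻¹ * holo M μ V x ∈ Good (s - M * η) :=
        hpert s (M * η) _ hx _ ((unitaryUnits (Matrix n n ℂ)).mul_mem ((unitaryUnits _).inv_mem hQMu) hWu)
          (by rw [norm_sub_rev]; exact (norm_sub_inv_mul_le hQMu hWu).trans (norm_ladder_sub_one_le (μ := μ) hU hS hi _ M))
      have hrel : holo M μ V (x + e i)
          = (V (lineBase M μ x) i)⁻¹ * ((hol V (lineBase M μ x) (ladder (seg μ (M : ℤ)) i))⁻¹ * holo M μ V x) * (V (lineBase M μ x) i)⁻¹⁻¹ := by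
        rw [holo_transverse hi hP x, inv_inv, mul_assoc ((V (lineBase M μ x) i)⁻¹)]
      rw [hrel]
      exact hconj _ _ hY _ ((unitaryUnits (Matrix n n ℂ)).inv_mem (hU _ _))
  -- `t` steps in direction `i`
  have hline : ∀ (i : Fin 4) (t : ℕ) (s : ℝ) (z : Site 4), holo M μ V z ∈ Good s →
      holo M μ V (z + (t : ℤ) • e i) ∈ Good (s - t * (M * η)) := by
    intro i t
    induction t with
    | zero => intro s z hz; simpa using hz
    | succ t ih =>
        intro s z hz
        have h := hstep _ _ i (ih s z hz)
        have e1 : z + ((t : ℕ) : ℤ) • e i + e i = z + ((t + 1 : ℕ) : ℤ) • e i := by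
          push_cast; rw [add_smul, one_smul, add_assoc]
        rw [e1] at h
        refine hmono _ _ (le_of_eq ?_) h
        push_cast; ring
  -- box sites along the comb, then periodic reduction
  intro x
  refine periodic_reduce hM (p := fun z => holo M μ V z ∈ Good (s₀ - 4 * M * (M * η))) (fun z i => by rw [holo_add_period hP]) ?_ x
  intro y hy
  have hnat : natSite y = (0 : Site 4) + ((y 0 : ℕ) : ℤ) • e 0 + ((y 1 : ℕ) : ℤ) • e 1 + ((y 2 : ℕ) : ℤ) • e 2 + ((y 3 : ℕ) : ℤ) • e 3 := by
    funext j
    fin_cases j <;> simp [natSite, e_apply]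
  have h := hline 3 (y 3) _ _ (hline 2 (y 2) _ _ (hline 1 (y 1) _ _ (hline 0 (y 0) _ _ h0)))
  rw [← hnat] at h
  refine hmono _ _ ?_ h
  have hyi : ∀ i, (y i : ℝ) ≤ (M : ℝ) - 1 := fun i => by
    have h1 : y i + 1 ≤ M := hy i
    have h2 : ((y i + 1 : ℕ) : ℝ) ≤ (M : ℝ) := by exact_mod_cast h1
    push_cast at h2; linarith
  nlinarith [hyi 0, hyi 1, hyi 2, hyi 3, hMη]

end Spread

end

end Summit.QuantumFields.BalabanUV.T4Continuum.TorusHolonomySpreading
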